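import Summits.BirchSwinnertonDyer.BirchSwinnertonDyer.Theorems.AdditiveBranchIMCGordTwoRankZeroCompanionDoorsSix
import Summits.BirchSwinnertonDyer.BirchSwinnertonDyer.Theorems.AdditiveBranchIMCMultLowerCompanionAtP
import HarnessLib

/-!
# Crux `GordTwoRankZeroOffCaseOne` (item 19357): the companion / visibility doors with the additive place `p` PAID
# (option (a): the witness is `p`-divisible in `W'(ℚ_p)`, formal group at depth `2`) — for partners whose `p*`-twist is
# NOT good at `p` (e.g. the Door-3 rows: partner of multiplicative twist type; Hesse-pencil members of other Kodaira type)

Cell `bsd-addord`, seat `bsd-addord-k1-c2` (D-0074 row B1), gen 5. HONEST FRAMING: nothing here proves the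
Birch–Swinnerton-Dyer conjecture or the crux; THEOREMS ONLY (no definition, no named fact, no `sorry`); per pair
(a per-pair record instantiates these shapes); the crux stays OPEN at class level.

## Why

The twist-model doors (`…twistModels_witness[₆]`, `…CompanionDoors[Six].lean`) make the place `p` FREE by Mazur–Rubin
2015 twisted (kind (vi)), which needs the PARTNER to be a `p*`-twist of a curve good at `p`. For a partner `W'` that is a
`p*`-twist of a MULTIPLICATIVE curve (the 8 "Door-3" rows of the k1-c2 g3 census have only such partners in Cremona's
range) or a Hesse-pencil member of another Kodaira type at `p`, the place `p` must be PAID instead: option (a), the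
witness `P` (or a prime-to-`p` multiple) lies in `Ŵ'(p²ℤ_p) ⊆ p·W'(ℚ_p)` — decidable on the coordinates
(`GaloisImage.exists_nsmul_eq_baseChange_of_dvd_den`: `p ∣ den x`, `p² ∣ num (x/y)`). These doors are team b2b's
six-option witness theorem `Supersingular.exists_sha_ne_zero_of_congr_of_witness₆` (x10b gen 26; options (a)/(i)/(ii)/
(iii)/(iv)/(v), the last — both curves GOOD above `p`, Mazur–Rubin untwisted `hMR` — never used on this cell) composed
with Cassels–Tate squareness exactly as in `…CompanionDoors.lean`, plus the `BSD(E,p)` twin with Kato's upper half on the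
semistable-twist locus. No twist model of the partner is needed; the target's twist model enters only the upper half.

* `missingLowerBoundAt_rankZero_irr_of_witness₆` — `ord_p #Ш(E)_an ≤ ord_p #Ш(E)` (odd `p`, `E[p]` irreducible, `r_an = 0`,
  `ord_p #Ш_an ≤ 2`; partner `W'`, `θ`, `S`, witness `P ∉ pW'(ℚ)`, six local options). Named facts `hCT hGZK hU hU2 hF44 hMR`.
* `bsdp_rankZero_surj_of_witness₆` — `BSD(E,p)`, `p ≥ 5`, `Addv W p`, `GoodOrd V p` for the target's twist model, `ρ̄` onto;
  `+ hK hDel98 hPal hmod hmodD`.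
* Option (a) from a prime-to-`p` MULTIPLE at the place of `p` is k1-c4's
  `AdditiveBranchIMCMultLowerCompanion.exists_nsmul_eq_baseChange_of_nsmul_dvd_den_depth` (`…MultLowerCompanionAtP.lean`, imported).

References: Mazur–Rubin 2015 Thm. 3.1 [MazurRubin2015SelmerCompanions]; Cremona–Mazur 2000 §3 [CremonaMazur2000];
Agashe–Stein 2002 Lemma 3.6 [AgasheStein2002]; Fisher 2016 Thm. 4.4 [Fisher2016Visualizing7]; Silverman ATAEC V.5.3/5.4
[SilvermanATAEC1994]; Silverman AEC IV.6.4, VII.2.2, X.4.14 [SilvermanAEC2009]; Kato 2004 Thm. 17.4 [Kato2004Asterisque];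
Delbourgo 1998 Prop. 4 [Delbourgo1998]; Pal 2012 Thm. 3.2 [Pal2012]; Miller 2011 Def. 1.1 [Miller2011LMS].
-/

set_option autoImplicit false

noncomputable section

open scoped Classical

open WeierstrassCurve Literature.NumberTheory.EllipticCurves
  Literature.NumberTheory.EllipticCurves.Rank1Residual
  Literature.NumberTheory.EllipticCurves.Rank1Residual.Typed
  Literature.NumberTheory.EllipticCurves.Wuthrich2014
  Literature.NumberTheory.EllipticCurves.Fisher2016
  Literature.NumberTheory.EllipticCurves.MazurRubin2015
  Literature.NumberTheory.GaloisRepresentations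
  Summit.BirchSwinnertonDyer.Rank1Residual.GaloisImage
  Summit.BirchSwinnertonDyer.Rank1Residual.Supersingular
open NumberField IsDedekindDomain Rat.HeightOneSpectrum Field
  Literature.NumberTheory.EllipticCurves.ModularForms

set_option linter.dupNamespace false

namespace Summit.BirchSwinnertonDyer.BirchSwinnertonDyer.Theorems.AdditiveBranchIMCGordTwoRankZeroCompanion

open Summit.BirchSwinnertonDyer.Rank1Residual
open Summit.BirchSwinnertonDyer.Rank1Residual.Additive

section DoorsPaid

variable {W : WeierstrassCurve ℚ} [W.IsElliptic] [W.IsGloballyMinimal] {p : ℕ} [hp : Fact p.Prime]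

omit [W.IsGloballyMinimal] in
/-- **The LOWER half by visibility, partner-twist-free, SIX-option local dispatch** (options (a)/(i)/(ii)/(iii)/(iv)/(v) of
team b2b's witness theorem; on cell (G-ord, `e = 2`) the place `p` is served by (a)). `E[p]` irreducible, odd `p`, `r_an = 0`,
`#Ш_an = q` with `ord_p q ≤ 2`; partner `W'`, `θ : W'[p] ⥲ W[p]`, places `S`, ONE witness `P ∈ W'(ℚ) ∖ pW'(ℚ)`. Named facts:
Cassels–Tate, GZK, Tate uniformisation (`hU`, `hU2`), Fisher 2016 Thm. 4.4 (`hF44`), Mazur–Rubin 2015 (`hMR`). Per pair; NOT a class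
theorem; nothing booked. [cite: CremonaMazur2000, §3 and Table 1] [cite: AgasheStein2002, Lemma 3.6] [cite: MazurRubin2015SelmerCompanions, Thm. 3.1]
[cite: Fisher2016Visualizing7, Thm. 4.4 (p. 106)] [cite: SilvermanATAEC1994, Ch. V Thm. 5.3, Cor. 5.4] [cite: SilvermanAEC2009, Thm. X.4.14] -/
theorem missingLowerBoundAt_rankZero_irr_of_witness₆
    (hCT : exists_casselsTate_pairing (K := ℚ)) (hGZK : rank_eq_analyticRank_of_analyticRank_le_one)
    (hU : Silverman1994_thmV53_tateUniformisation.{0})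
    (hU2 : Silverman1994_thmV53_corV54_tateUniformisation.{0})
    (hF44 : thm44_selmerLocalKer_iff_of_nonsplit_good) (hMR : selmerLocalKer_iff_of_goodReduction_above)
    (hp2 : p ≠ 2) (hirr : Irr W p) (hr : W.analyticRank = 0)
    {q : ℚ} (hq : shaAn W = (q : ℂ)) (hv : padicValRat p q ≤ 2)
    (W' : WeierstrassCurve ℚ) [W'.IsElliptic]
    (θ : geomTorsion W' (p : ℤ) ≃+ geomTorsion W (p : ℤ))
    (hθ : ∀ (σ : absoluteGaloisGroup ℚ) (P : geomTorsion W' (p : ℤ)), θ (σ • P) = σ • θ P)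
    (S : Finset (HeightOneSpectrum (𝓞 ℚ)))
    (hS : ∀ w : HeightOneSpectrum (𝓞 ℚ), w ∉ S →
      W.HasGoodReductionAt w ∧ W'.HasGoodReductionAt w ∧ (p : 𝓞 ℚ) ∉ w.asIdeal)
    (P : W'.toAffine.Point)
    (hP : P ∉ (zsmulAddGroupHom (p : ℤ) : W'.toAffine.Point →+ W'.toAffine.Point).range)
    (hplaces : ∀ w ∈ S,
      (∃ Q : (W'.baseChange (w.adicCompletion ℚ)).toAffine.Point,
        p • Q = WeierstrassCurve.Affine.Point.baseChange (W' := W') ℚ (w.adicCompletion ℚ) P) ∨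
      ((p : 𝓞 ℚ) ∉ w.asIdeal ∧ Nat.card (nsmulAddMonoidHom p :
          (W'.baseChange (w.adicCompletion ℚ)).toAffine.Point →+ _).ker = 1) ∨
      (W.HasSplitMultiplicativeReductionAt w ∧ W'.HasSplitMultiplicativeReductionAt w ∧
        Nat.card (nsmulAddMonoidHom p :
          (W.baseChange (w.adicCompletion ℚ)).toAffine.Point →+ _).ker ≤ p) ∨
      (W.HasMultiplicativeReductionAt w ∧ W'.HasMultiplicativeReductionAt w ∧
        (∃ r : w.adicCompletion ℚ, algebraMap ℚ (w.adicCompletion ℚ) (-(W.c₄ / W.c₆)) =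
          r ^ 2 * algebraMap ℚ (w.adicCompletion ℚ) (-(W'.c₄ / W'.c₆))) ∧
        (∀ ζ : w.adicCompletion ℚ, ζ ^ p = 1 → ζ = 1)) ∨
      ((W.HasMultiplicativeReductionAt w ∧ ¬ W.HasSplitMultiplicativeReductionAt w ∧
          W'.HasGoodReductionAt w) ∨
        (W.HasGoodReductionAt w ∧ W'.HasMultiplicativeReductionAt w ∧
          ¬ W'.HasSplitMultiplicativeReductionAt w)) ∨
      ((p : 𝓞 ℚ) ∈ w.asIdeal ∧ W.HasGoodReductionAt w ∧ W'.HasGoodReductionAt w)) :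
    MissingLowerBoundAt W p := by
  haveI hfin : Finite W.toAffine.Point := finite_point_of_analyticRank_eq_zero W hGZK hr
  have hcop : (Nat.card W.toAffine.Point).Coprime p := coprime_natCard_point_of_irr W p hirr
  have hex : ∃ c : W.sha, c ≠ 0 ∧ p • c = 0 :=
    Supersingular.exists_sha_ne_zero_of_congr_of_witness₆ hU hU2 hF44 hMR hp2 θ hθ S hS hfin hcop P hP hplaces
  have hfinSha : W.ShaFinite := (hGZK W (by rw [hr]; norm_num)).2
  exact missingLowerBoundAt_of_casselsTate_of_pow_dvd W p hCT hfinSha hq (k := 1) (by simpa using hv)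
    (by simpa using dvd_shaOrder_of_exists_torsion W p hex)

/-- **`BSD(E,p)` by visibility, partner-twist-free, SIX-option local dispatch, `p ≥ 5`**: `E = W` additive at `p` (`Addv W p`)
with a globally minimal good ORDINARY twist model `C • V^{(p*)} = W` (`GoodOrd V p`, needed for the UPPER half only —
`Addv.missingUpperBoundAt_rankZero_of_semistableTwist_of_surj`), `ρ̄_{E,p}` onto, `r_an = 0`, `ord_p #Ш_an ≤ 2`, and the witness
data of `missingLowerBoundAt_rankZero_irr_of_witness₆`. Per pair modulo `hCT hGZK hU hU2 hF44 hMR hK hDel98 hPal hmod hmodD`; books nothing.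
[cite: CremonaMazur2000, §3 and Table 1] [cite: MazurRubin2015SelmerCompanions, Thm. 3.1] [cite: Kato2004Asterisque, Thm. 17.4 (3) (p. 273)]
[cite: Delbourgo1998, Prop. 4 (p. 144)] [cite: Pal2012, Thm. 3.2] [cite: Miller2011LMS, Def. 1.1] -/
theorem bsdp_rankZero_surj_of_witness₆
    (hCT : exists_casselsTate_pairing (K := ℚ)) (hGZK : rank_eq_analyticRank_of_analyticRank_le_one)
    (hU : Silverman1994_thmV53_tateUniformisation.{0})
    (hU2 : Silverman1994_thmV53_corV54_tateUniformisation.{0})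
    (hF44 : thm44_selmerLocalKer_iff_of_nonsplit_good) (hMR : selmerLocalKer_iff_of_goodReduction_above)
    (hK : Wuthrich2014.kato_halfEigenCharIdeal_dvd_cyclotomicPrime_of_surjective)
    (hDel98 : Delbourgo1998.prop4_rankZero_pow_dvd_constantCoeff)
    (hPal : Pal2012.thm32_sqrt_mul_realPeriodRat_twist_eq_of_prime_one_mod_four)
    (hmod : hasEntireLFunction_rat) (hmodD : nonempty_modularParametrizationData)
    (hadd : Addv W p) (hsurj : Surj W p) (hp5 : 5 ≤ p) (hr : W.analyticRank = 0)
    {q : ℚ} (hq : shaAn W = (q : ℂ)) (hv : padicValRat p q ≤ 2)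
    (V : WeierstrassCurve ℚ) [V.IsElliptic] [V.IsGloballyMinimal] (C : VariableChange ℚ)
    (hWV : C • V.quadraticTwist ((-1 : ℚ) ^ (p / 2) * p) = W) (hVord : GoodOrd V p)
    (W' : WeierstrassCurve ℚ) [W'.IsElliptic]
    (θ : geomTorsion W' (p : ℤ) ≃+ geomTorsion W (p : ℤ))
    (hθ : ∀ (σ : absoluteGaloisGroup ℚ) (P : geomTorsion W' (p : ℤ)), θ (σ • P) = σ • θ P)
    (S : Finset (HeightOneSpectrum (𝓞 ℚ)))
    (hS : ∀ w : HeightOneSpectrum (𝓞 ℚ), w ∉ S →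
      W.HasGoodReductionAt w ∧ W'.HasGoodReductionAt w ∧ (p : 𝓞 ℚ) ∉ w.asIdeal)
    (P : W'.toAffine.Point)
    (hP : P ∉ (zsmulAddGroupHom (p : ℤ) : W'.toAffine.Point →+ W'.toAffine.Point).range)
    (hplaces : ∀ w ∈ S,
      (∃ Q : (W'.baseChange (w.adicCompletion ℚ)).toAffine.Point,
        p • Q = WeierstrassCurve.Affine.Point.baseChange (W' := W') ℚ (w.adicCompletion ℚ) P) ∨
      ((p : 𝓞 ℚ) ∉ w.asIdeal ∧ Nat.card (nsmulAddMonoidHom p :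
          (W'.baseChange (w.adicCompletion ℚ)).toAffine.Point →+ _).ker = 1) ∨
      (W.HasSplitMultiplicativeReductionAt w ∧ W'.HasSplitMultiplicativeReductionAt w ∧
        Nat.card (nsmulAddMonoidHom p :
          (W.baseChange (w.adicCompletion ℚ)).toAffine.Point →+ _).ker ≤ p) ∨
      (W.HasMultiplicativeReductionAt w ∧ W'.HasMultiplicativeReductionAt w ∧
        (∃ r : w.adicCompletion ℚ, algebraMap ℚ (w.adicCompletion ℚ) (-(W.c₄ / W.c₆)) =
          r ^ 2 * algebraMap ℚ (w.adicCompletion ℚ) (-(W'.c₄ / W'.c₆))) ∧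
        (∀ ζ : w.adicCompletion ℚ, ζ ^ p = 1 → ζ = 1)) ∨
      ((W.HasMultiplicativeReductionAt w ∧ ¬ W.HasSplitMultiplicativeReductionAt w ∧
          W'.HasGoodReductionAt w) ∨
        (W.HasGoodReductionAt w ∧ W'.HasMultiplicativeReductionAt w ∧
          ¬ W'.HasSplitMultiplicativeReductionAt w)) ∨
      ((p : 𝓞 ℚ) ∈ w.asIdeal ∧ W.HasGoodReductionAt w ∧ W'.HasGoodReductionAt w)) :
    BSDp W p := by
  have hp2 : p ≠ 2 := by omega
  have hirr : Irr W p := hasIrreducibleModPGaloisRep_of_hasSurjectiveModNGaloisRep W p hsurj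
  have hlow : MissingLowerBoundAt W p :=
    missingLowerBoundAt_rankZero_irr_of_witness₆ hCT hGZK hU hU2 hF44 hMR hp2 hirr hr hq hv W' θ hθ S hS P hP hplaces
  exact bsdp_of_missingPPartAt W p hGZK (by omega)
    (missingPPartAt_of_lower_of_upper W p hlow
      (Addv.missingUpperBoundAt_rankZero_of_semistableTwist_of_surj hK hDel98 hPal hGZK hmod hmodD hp5
        hadd V C hWV (Or.inl hVord) hsurj hr))

end DoorsPaid

end Summit.BirchSwinnertonDyer.BirchSwinnertonDyer.Theorems.AdditiveBranchIMCGordTwoRankZeroCompanion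

end
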